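import Mathlib
import Summits.CriticalPhenomena.CardyFormulaZ2.Theorems.CardyMagicRigidityNestingRigidityTreeRigidityTameAssemblyInteriors
import Summits.CriticalPhenomena.CardyFormulaZ2.Theorems.CardyMagicRigidityNestingRigidityTreeRigidityTameAssemblyInner
import HarnessLib

/-!
# Stub `treeRigidityTame_of_tameRigidity`: the assembly, conditional on convergence of the lattice count laws

Crux `Summit.CriticalPhenomena.CardyFormulaZ2.Theses.CardyMagicRigidity.NestingRigidity`
(stmt-CriticalPhenomena-4835), line `positive-cone-weight-doubling`, registered helper
`treeRigidityTame_of_tameRigidity : (tame rigidity) → TreeRigidityTame` (vocabulary of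
`Theorems/CardyMagicRigidityPositiveConeJointDefs.lean`, p130599).  With steps (1b) (a.e. data → all data,
`measure_typedCylinder_eq_of_ae_eq`, p131863), the ROUTING-BLIND law-level core (equal joint typed cylinder
probabilities ⇒ a coupling with a.s. equal typed counts and typed interior-preserving loop bijections,
`exists_coupling_typed_interiorEquiv_of_typedCylinders_eq`, p132016), (2)–(3) (⇒ `d_CN(X, X') = 0` under
a rigidity hypothesis, `cnLawEDist_eq_zero_of_typedCylinders_eq`, p131672) and (4) (gluing,
`tendsto_cnLawEDist_zEns_tEns_of_limits`, p131483) landed, everything reduces to ONE remaining input,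
step (1a): along the mesh sequence, the joint typed cylinder probabilities OF THE LATTICE ensembles
converge, for a.e. datum, to those OF THE LIMIT PRESENTATIONS `X` (bond-`ℤ²`) and `X'` (site-`𝕋`).  This
file proves the stub, and its routing-blind core, CONDITIONALLY on that input, written inline as two
hypotheses of the shape of `TypedJointNestingLawAgreement` (no new definition):

* §1 `ae_measure_typedCylinder_eq_of_limits` (registered anchor, routing-blind) — typed joint law
  agreement ON THE LATTICE (`TypedJointNestingLawAgreement`) plus convergence of the lattice cylinder
  probabilities to those of `X`, resp. `X'`, give equality of the joint typed cylinder probabilities of `X`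
  and `X'` at a.e. positive datum (limits of asymptotically equal sequences; `ENNReal.toReal` is injective
  on finite values); `measure_typedCylinder_rat_eq_of_cylinderLimits` — hence at every positive RATIONAL
  datum (p131863), i.e. the typed joint count vectors of the two limits have the same joint law there.
* §2 `exists_coupling_typed_interiorEquiv_of_cylinderLimits` (registered anchor, routing-blind) — under
  the hypotheses of `TreeRigidityTame` (a.e. `Regular` suffices) and the two convergence inputs, the two
  limit presentations can be coupled so that, almost surely, all typed counts at rational data agree AND
  the loops of each type are in an interior-preserving bijection (p132016).  This is what a repaired route
  (any correct rigidity class) consumes.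
* §3 `treeRigidityTame_of_cylinderLimits` (registered anchor) — adding the tame rigidity hypothesis of the
  registered helper (now reported REFUTED by a two-mouth-lake pair of tame loops, hence vacuous, but the
  implication is a theorem): `d_CN(bond_{δₖ}, site_{δₖ}) → 0`.

Why the convergence input is NOT a consequence of the other hypotheses (and hence why the registered stub
is not closed unconditionally): `d_CN`-convergence of laws does not see multiplicities — two distinct
lattice loops at vanishing distance from each other collapse to ONE limit loop, and a limit presentation may
carry a loop together with its time reversal (so the statement "the typed count vectors of `X` and `X'`
have the same law" is even false for general presentations satisfying all hypotheses of
`TreeRigidityTame`: replace `X` by its reversal closure) — so the laws of the (multiplicity-counting)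
pattern counts are not continuous along `d_CN`-convergent sequences without an a priori input on the
lattice side (no two distinct macroscopic loops of a window at vanishing `udist`, asymptotically in
probability) and a reversal-free presentation.  Both are natural deliverables of the precompactness step
(a Skorokhod-type presentation with a.s. convergent counts), where the lead is asked to register them.
-/

noncomputable section

open MeasureTheory Set Filter Metric
open scoped Real Topology BigOperators ENNReal

namespace Summit.CriticalPhenomena.CardyFormulaZ2.Cruxes.NestingRigidity.PositiveConeWeightDoubling

open Literature.Probability.RandomPlanarGeometry Literature.Probability.Percolation
  Literature.Probability.LatticeModels
open Summit.CriticalPhenomena.CardyFormulaZ2.Theses.CardyMagicRigidity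
open Summit.CriticalPhenomena.CardyFormulaZ2.Cruxes.NestingRigidity.RingCloudTomography

/-! ## §1 A.e. equality of the limit cylinder probabilities from the lattice -/

/-- **Lattice agreement + convergence to the limits ⇒ a.e. agreement of the limits (routing-blind;
registered anchor).**  If the typed joint
cylinder laws of bond-`ℤ²` and site-`𝕋` agree asymptotically (`TypedJointNestingLawAgreement`), and along
the mesh sequence `δs → 0⁺` the bond cylinder probabilities converge to those of the presentation `X` and
the site ones to those of `X'` (for a.e. positive datum, every table of values), then the joint typed
cylinder probabilities of `X` and `X'` agree at a.e. positive datum. -/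
theorem ae_measure_typedCylinder_eq_of_limits : ∀ {δs : ℕ → ℝ}, Tendsto δs atTop (𝓝[>] (0 : ℝ)) →
    ∀ {X X' : unitInterval → LoopConfig ℂ}, TypedJointNestingLawAgreement →
    (∀ (J n : ℕ) (x : Fin J → Fin n → ℂ), ∀ᵐ p : (Fin J → Fin n → ℝ) × (Fin J → ℝ),
      (∀ j i, 0 < p.1 j i) → (∀ j, 0 < p.2 j) → ∀ k : Fin J → Fin 2 → Finset (Fin n) → ℕ,
      Tendsto (fun m : ℕ ↦ (zEns.P {ω | ∀ j t, ∀ S : Finset (Fin n), S.Nonempty →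
        typedPatternCount (zEns.X (δs m) ω) t (x j) (p.1 j) (p.2 j) S = k j t S}).toReal) atTop
        (𝓝 ((volume {s : unitInterval | ∀ j t, ∀ S : Finset (Fin n), S.Nonempty →
          typedPatternCount (X s) t (x j) (p.1 j) (p.2 j) S = k j t S}).toReal))) →
    (∀ (J n : ℕ) (x : Fin J → Fin n → ℂ), ∀ᵐ p : (Fin J → Fin n → ℝ) × (Fin J → ℝ),
      (∀ j i, 0 < p.1 j i) → (∀ j, 0 < p.2 j) → ∀ k : Fin J → Fin 2 → Finset (Fin n) → ℕ,
      Tendsto (fun m : ℕ ↦ (tEns.P {ω | ∀ j t, ∀ S : Finset (Fin n), S.Nonempty →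
        typedPatternCount (tEns.X (δs m) ω) t (x j) (p.1 j) (p.2 j) S = k j t S}).toReal) atTop
        (𝓝 ((volume {s : unitInterval | ∀ j t, ∀ S : Finset (Fin n), S.Nonempty →
          typedPatternCount (X' s) t (x j) (p.1 j) (p.2 j) S = k j t S}).toReal))) →
    ∀ (J n : ℕ) (x : Fin J → Fin n → ℂ),
    ∀ᵐ p : (Fin J → Fin n → ℝ) × (Fin J → ℝ), (∀ j i, 0 < p.1 j i) → (∀ j, 0 < p.2 j) →
      ∀ k : Fin J → Fin 2 → Finset (Fin n) → ℕ,
      volume {s : unitInterval | ∀ j t, ∀ S : Finset (Fin n), S.Nonempty →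
        typedPatternCount (X s) t (x j) (p.1 j) (p.2 j) S = k j t S} =
      volume {s : unitInterval | ∀ j t, ∀ S : Finset (Fin n), S.Nonempty →
        typedPatternCount (X' s) t (x j) (p.1 j) (p.2 j) S = k j t S} := by
  intro δs hδs X X' hA hLZ hLT J n x
  filter_upwards [hA J n x, hLZ J n x, hLT J n x] with p hpA hpZ hpT hr hR k
  have h1 := hpZ hr hR k
  have h2 := hpT hr hR k
  have h3 := (hpA hr hR k).comp hδs
  have h4 := h1.sub h2
  have hab := tendsto_nhds_unique h4 h3
  rw [sub_eq_zero] at hab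
  exact (ENNReal.toReal_eq_toReal_iff' (measure_ne_top _ _) (measure_ne_top _ _)).1 hab

/-- **Equality of the joint typed cylinder probabilities of the two limits at every positive RATIONAL
datum** (routing-blind), for presentations with a.e. locally finite values and measurable typed counts,
under lattice agreement and the two convergence inputs: §1 and `measure_typedCylinder_eq_of_ae_eq`
(p131863).  In other words, at rational data the typed joint count vectors of `X` and `X'` have the same
joint law. -/
theorem measure_typedCylinder_rat_eq_of_cylinderLimits {δs : ℕ → ℝ}
    (hδs : Tendsto δs atTop (𝓝[>] (0 : ℝ))) {X X' : unitInterval → LoopConfig ℂ}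
    (hX : ∀ᵐ s : unitInterval, (X s).IsLocallyFinite) (hX' : ∀ᵐ s : unitInterval, (X' s).IsLocallyFinite)
    (hmeas : ∀ (i : Fin 2) (n : ℕ) (x : Fin n → ℂ) (r : Fin n → ℝ) (R : ℝ) (S : Finset (Fin n)),
      Measurable (fun s ↦ typedPatternCount (X s) i x r R S) ∧
      Measurable (fun s ↦ typedPatternCount (X' s) i x r R S))
    (hA : TypedJointNestingLawAgreement)
    (hLZ : ∀ (J n : ℕ) (x : Fin J → Fin n → ℂ), ∀ᵐ p : (Fin J → Fin n → ℝ) × (Fin J → ℝ),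
      (∀ j i, 0 < p.1 j i) → (∀ j, 0 < p.2 j) → ∀ k : Fin J → Fin 2 → Finset (Fin n) → ℕ,
      Tendsto (fun m : ℕ ↦ (zEns.P {ω | ∀ j t, ∀ S : Finset (Fin n), S.Nonempty →
        typedPatternCount (zEns.X (δs m) ω) t (x j) (p.1 j) (p.2 j) S = k j t S}).toReal) atTop
        (𝓝 ((volume {s : unitInterval | ∀ j t, ∀ S : Finset (Fin n), S.Nonempty →
          typedPatternCount (X s) t (x j) (p.1 j) (p.2 j) S = k j t S}).toReal)))
    (hLT : ∀ (J n : ℕ) (x : Fin J → Fin n → ℂ), ∀ᵐ p : (Fin J → Fin n → ℝ) × (Fin J → ℝ),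
      (∀ j i, 0 < p.1 j i) → (∀ j, 0 < p.2 j) → ∀ k : Fin J → Fin 2 → Finset (Fin n) → ℕ,
      Tendsto (fun m : ℕ ↦ (tEns.P {ω | ∀ j t, ∀ S : Finset (Fin n), S.Nonempty →
        typedPatternCount (tEns.X (δs m) ω) t (x j) (p.1 j) (p.2 j) S = k j t S}).toReal) atTop
        (𝓝 ((volume {s : unitInterval | ∀ j t, ∀ S : Finset (Fin n), S.Nonempty →
          typedPatternCount (X' s) t (x j) (p.1 j) (p.2 j) S = k j t S}).toReal)))
    (J : ℕ) (x : Fin J → Fin 2 → ℚ × ℚ) (r : Fin J → Fin 2 → ℚ) (R : Fin J → ℚ)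
    (k : Fin J → Fin 2 → Finset (Fin 2) → ℕ) (hr : ∀ j i, 0 < r j i) (hR : ∀ j, 0 < R j) :
    volume {s : unitInterval | ∀ j t, ∀ S : Finset (Fin 2), S.Nonempty →
      typedPatternCount (X s) t (fun i ↦ (⟨(x j i).1, (x j i).2⟩ : ℂ)) (fun i ↦ (r j i : ℝ)) (R j) S =
        k j t S} =
    volume {s : unitInterval | ∀ j t, ∀ S : Finset (Fin 2), S.Nonempty →
      typedPatternCount (X' s) t (fun i ↦ (⟨(x j i).1, (x j i).2⟩ : ℂ)) (fun i ↦ (r j i : ℝ)) (R j) S =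
        k j t S} := by
  have hae := ae_measure_typedCylinder_eq_of_limits hδs hA hLZ hLT J 2
    (fun j i ↦ (⟨(x j i).1, (x j i).2⟩ : ℂ))
  exact measure_typedCylinder_eq_of_ae_eq hX hX' hmeas (fun j i ↦ (⟨(x j i).1, (x j i).2⟩ : ℂ)) k
    (hae.mono fun p hp h1 h2 ↦ hp h1 h2 k) (fun j i ↦ (r j i : ℝ), fun j ↦ (R j : ℝ))
    (fun j i ↦ show (0 : ℝ) < (r j i : ℝ) by exact_mod_cast hr j i)
    (fun j ↦ show (0 : ℝ) < (R j : ℝ) by exact_mod_cast hR j)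

/-! ## §2 The routing-blind conclusion under the convergence inputs (registered anchor) -/

/-- **The two limits couple with a.s. equal typed interior multisets, conditionally on convergence of the
lattice count laws (routing-blind; registered anchor).**  Let `δs → 0⁺` and let `X`, `X'` be presentations
on `([0,1], Leb)` with a.e. `Regular` values and measurable typed pattern counts.  If the typed joint
cylinder laws agree on the lattice (`TypedJointNestingLawAgreement`) and the typed joint cylinder
probabilities of bond-`ℤ²` along `δs` converge to those of `X`, those of site-`𝕋` to those of `X'` (a.e.
positive datum), then there is a coupling `P` of `(Leb, Leb)` under which, almost surely, for each type the
loops of `X s` and of `X' s'` are in a bijection preserving the winding interiors.  (No `d_CN`-convergence,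
tameness or rigidity is used; the interiors-and-types statement is what any repaired rigidity class turns
into `d_CN((Leb, X), (Leb, X')) = 0`.) -/
theorem exists_coupling_typed_interiorEquiv_of_cylinderLimits : ∀ (δs : ℕ → ℝ)
    (X X' : unitInterval → LoopConfig ℂ), Tendsto δs atTop (𝓝[>] (0 : ℝ)) →
    (∀ᵐ s : unitInterval, Regular (X s)) → (∀ᵐ s : unitInterval, Regular (X' s)) →
    (∀ (i : Fin 2) (n : ℕ) (x : Fin n → ℂ) (r : Fin n → ℝ) (R : ℝ) (S : Finset (Fin n)),
      Measurable (fun s ↦ typedPatternCount (X s) i x r R S) ∧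
      Measurable (fun s ↦ typedPatternCount (X' s) i x r R S)) →
    TypedJointNestingLawAgreement →
    (∀ (J n : ℕ) (x : Fin J → Fin n → ℂ), ∀ᵐ p : (Fin J → Fin n → ℝ) × (Fin J → ℝ),
      (∀ j i, 0 < p.1 j i) → (∀ j, 0 < p.2 j) → ∀ k : Fin J → Fin 2 → Finset (Fin n) → ℕ,
      Tendsto (fun m : ℕ ↦ (zEns.P {ω | ∀ j t, ∀ S : Finset (Fin n), S.Nonempty →
        typedPatternCount (zEns.X (δs m) ω) t (x j) (p.1 j) (p.2 j) S = k j t S}).toReal) atTop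
        (𝓝 ((volume {s : unitInterval | ∀ j t, ∀ S : Finset (Fin n), S.Nonempty →
          typedPatternCount (X s) t (x j) (p.1 j) (p.2 j) S = k j t S}).toReal))) →
    (∀ (J n : ℕ) (x : Fin J → Fin n → ℂ), ∀ᵐ p : (Fin J → Fin n → ℝ) × (Fin J → ℝ),
      (∀ j i, 0 < p.1 j i) → (∀ j, 0 < p.2 j) → ∀ k : Fin J → Fin 2 → Finset (Fin n) → ℕ,
      Tendsto (fun m : ℕ ↦ (tEns.P {ω | ∀ j t, ∀ S : Finset (Fin n), S.Nonempty →
        typedPatternCount (tEns.X (δs m) ω) t (x j) (p.1 j) (p.2 j) S = k j t S}).toReal) atTop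
        (𝓝 ((volume {s : unitInterval | ∀ j t, ∀ S : Finset (Fin n), S.Nonempty →
          typedPatternCount (X' s) t (x j) (p.1 j) (p.2 j) S = k j t S}).toReal))) →
    ∃ P : Measure (unitInterval × unitInterval), P.map Prod.fst = volume ∧ P.map Prod.snd = volume ∧
      ∀ᵐ q ∂P, ∀ i : Fin 2, ∃ e : (X q.1).F i ≃ (X' q.2).F i, ∀ u : (X q.1).F i,
        {w | (e u : UnbasedLoop ℂ).wind w ≠ 0} = {w | (u : UnbasedLoop ℂ).wind w ≠ 0} := by
  intro δs X X' hδs hX hX' hmeas hA hLZ hLT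
  refine exists_coupling_typed_interiorEquiv_of_typedCylinders_eq X X' hX hX' hmeas
    fun J x r R k hr hR ↦ ?_
  exact measure_typedCylinder_rat_eq_of_cylinderLimits hδs (hX.mono fun s hs ↦ hs.locallyFinite)
    (hX'.mono fun s hs ↦ hs.locallyFinite) hmeas hA hLZ hLT J x r R k hr hR

/-! ## §3 The conditional assembly of the registered helper (registered anchor) -/

/-- **`treeRigidityTame_of_tameRigidity`, conditionally on convergence of the lattice count laws
(registered anchor).**  Assume tame rigidity (reported refuted: the implication is then vacuous, but it is
stated for whatever the hypothesis is worth).  Let `δs → 0⁺`, let bond-`ℤ²` converge in `d_CN` to the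
presentation `X` on `([0,1], Leb)` and site-`𝕋` to `X'`, both with a.e. `Regular` values carrying `Tame`
loops and measurable typed pattern counts, let the outer exceptional events of the pair (site, `X`) be
measurable, and let the typed joint cylinder laws agree on the lattice (`TypedJointNestingLawAgreement`).
IF MOREOVER the typed joint cylinder probabilities of bond-`ℤ²` along `δs` converge to those of `X`, and
those of site-`𝕋` to those of `X'` (a.e. positive datum, every finite set of disc families, every table of
values), THEN `d_CN(bond_{δs k}, site_{δs k}) → 0`.  Proof: §1 at rational data,
`cnLawEDist_eq_zero_of_typedCylinders_eq` (p131672) gives `d_CN(X, X') = 0`, and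
`tendsto_cnLawEDist_zEns_tEns_of_limits` (p131483) glues. -/
theorem treeRigidityTame_of_cylinderLimits :
    (∀ u v : UnbasedLoop ℂ, Tame u → Tame v → (∀ z, u.wind z = v.wind z) → u = v) →
    ∀ (δs : ℕ → ℝ) (X X' : unitInterval → LoopConfig ℂ), Tendsto δs atTop (𝓝[>] (0 : ℝ)) →
    Tendsto (fun k : ℕ ↦ LoopConfig.cnLawEDist zEns.P (zEns.X (δs k)) volume X) atTop (𝓝 0) →
    Tendsto (fun k : ℕ ↦ LoopConfig.cnLawEDist tEns.P (tEns.X (δs k)) volume X') atTop (𝓝 0) →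
    (∀ᵐ s : unitInterval, Regular (X s) ∧ ∀ u ∈ (X s).loops, Tame u) →
    (∀ᵐ s : unitInterval, Regular (X' s) ∧ ∀ u ∈ (X' s).loops, Tame u) →
    (∀ (i : Fin 2) (n : ℕ) (x : Fin n → ℂ) (r : Fin n → ℝ) (R : ℝ) (S : Finset (Fin n)),
      Measurable (fun s ↦ typedPatternCount (X s) i x r R S) ∧
      Measurable (fun s ↦ typedPatternCount (X' s) i x r R S)) →
    (∀ (ε : ℝ) (k : ℕ), MeasurableSet {p : tEns.Ω × unitInterval |
      LoopConfig.IsClose ε (tEns.X (δs k) p.1) (X p.2)}) →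
    TypedJointNestingLawAgreement →
    (∀ (J n : ℕ) (x : Fin J → Fin n → ℂ), ∀ᵐ p : (Fin J → Fin n → ℝ) × (Fin J → ℝ),
      (∀ j i, 0 < p.1 j i) → (∀ j, 0 < p.2 j) → ∀ k : Fin J → Fin 2 → Finset (Fin n) → ℕ,
      Tendsto (fun m : ℕ ↦ (zEns.P {ω | ∀ j t, ∀ S : Finset (Fin n), S.Nonempty →
        typedPatternCount (zEns.X (δs m) ω) t (x j) (p.1 j) (p.2 j) S = k j t S}).toReal) atTop
        (𝓝 ((volume {s : unitInterval | ∀ j t, ∀ S : Finset (Fin n), S.Nonempty →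
          typedPatternCount (X s) t (x j) (p.1 j) (p.2 j) S = k j t S}).toReal))) →
    (∀ (J n : ℕ) (x : Fin J → Fin n → ℂ), ∀ᵐ p : (Fin J → Fin n → ℝ) × (Fin J → ℝ),
      (∀ j i, 0 < p.1 j i) → (∀ j, 0 < p.2 j) → ∀ k : Fin J → Fin 2 → Finset (Fin n) → ℕ,
      Tendsto (fun m : ℕ ↦ (tEns.P {ω | ∀ j t, ∀ S : Finset (Fin n), S.Nonempty →
        typedPatternCount (tEns.X (δs m) ω) t (x j) (p.1 j) (p.2 j) S = k j t S}).toReal) atTop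
        (𝓝 ((volume {s : unitInterval | ∀ j t, ∀ S : Finset (Fin n), S.Nonempty →
          typedPatternCount (X' s) t (x j) (p.1 j) (p.2 j) S = k j t S}).toReal))) →
    Tendsto (fun k : ℕ ↦ LoopConfig.cnLawEDist zEns.P (zEns.X (δs k)) tEns.P (tEns.X (δs k)))
      atTop (𝓝 0) := by
  intro hrig δs X X' hδs hZ hT hX hX' hmeas hclose hA hLZ hLT
  refine tendsto_cnLawEDist_zEns_tEns_of_limits δs X X' hZ hT hclose ?_
  refine cnLawEDist_eq_zero_of_typedCylinders_eq hrig X X' hX hX' hmeas fun J x r R k hr hR ↦ ?_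
  exact measure_typedCylinder_rat_eq_of_cylinderLimits hδs (hX.mono fun s hs ↦ hs.1.locallyFinite)
    (hX'.mono fun s hs ↦ hs.1.locallyFinite) hmeas hA hLZ hLT J x r R k hr hR

end Summit.CriticalPhenomena.CardyFormulaZ2.Cruxes.NestingRigidity.PositiveConeWeightDoubling

end
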